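import Summits.QuantumFields.YangMills.Theorems.UnitScaleTiltProp7TrueLinCentral
import Summits.QuantumFields.YangMills.Theorems.UnitScaleTiltProp7QTwSScalarSectorRegPr
import Literature.MathematicalPhysics.QuantumFieldTheory.Balaban1983to89.T3DescentFibreTower
import HarnessLib

/-!
# Route `UnitScaleTilt`, crux K1 child «MinimiserStabilityRegPr» (stmt-QuantumFields-19200), stub `stub_existenceMinimalOrbit` (EX), lane II (B4★)∕(QB) «⊕ central» summand —
# **THE CURVED TRUE-LINEARISED FAMILY EQUALS THE FLAT ONE ON THE CENTRE, ON PRINT'S REGULAR SPACE `𝔘_k(ε₀)`** (the member corollary of ✓`Prop7TrueLinCentral.trueLinIter_smul_one_eq'`):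
# at `W ∈ RegPr F n K ε₀` (`10⁷L³ε₀ ≤ 1`) the `hQs`-family `Q` of ✓`Prop7EngOfTrueAvgBudget.hEng_of_trueAvgBudget`'s `hQB` along `W̄^{(·)}` and the same family `Q₁` along the flat tower satisfy
# **`Q k (c·1) = Q₁ k (c·1)`** and **`Q k (c·1) e ∈ ℂ·1`** for every `k ≤ K − n` — the loop windows of ✓`trueLinIter_smul_one_eq'` DISCHARGED: at `W` by [Balaban1985Variational] (146)
# (✓`plaqSmall_iter_T3_allL`) ∘ Stokes (✓`dist1_loopHol_le`) ∘ ✓`loop_budget_eighth` (the chain of ✓`loopHolU_emlIterU_bgUnits_le_eighth_of_regPr`, SU letters), at `1` trivially (`W̄^{(j)}(1) = 1`).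

Cell `ym3-torus`, width seat `ym3-torus-px10` (gen 5).  `--supports stmt-QuantumFields-19200 --as helper`; THEOREMS ONLY (0 `def`, 0 `sorry`); count-neutral; nothing here claims the
stub, the crux, d = 4 or the mass gap — YM₃ on T³ is a ladder rung (R3), not the Clay problem.

WHAT IS PROVED:
* §1 `iter_blockAvg_expMeanLogSU_one` (`W̄^{(j)}(1) = 1` for the printed `exp[mean log]` block averaging, any `SU(n)`, any `P`; lit `T3DescentFibreTower.avgFun_one` ∘ `expMeanLogSU_E_one`),
  `loops_iter_one` (its loop variables are `1`).
* §2 ★`loops_iter_le_eighth_of_regPr` — at `W ∈ RegPr F n K ε₀`, `10⁷L³ε₀ ≤ 1`: `‖W̄^{(j)}(loop) − 1‖ ≤ 1∕8` and `< δ₂` at every level `j ≤ K − n` (SU letters).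
* §3 ★★★`trueLinIter_smul_one_eq_flat_of_regPr` (statement above; second clause `∀ e, ∃ s, Q k (c·1) e = s·1`).
HONEST SCOPE.  By-name assembly; nothing of (QB)∕(ENG)∕(REC)∕`hN06`∕the crux is advanced by this file alone; nothing of print is asserted.

References: T. Bałaban, CMP **102** (1985) 277–309 [Balaban1985Variational] ((2) p.278, (146) p.301); CMP **95** (1984) 17–40 [Balaban1984PropagatorsI] ((1.18)–(1.20) pp.19–20); CMP **99**
(1985) 389–434 [Balaban1985BackgroundPropagators] ((3.14)–(3.15) p.393); CMP **109** (1987) 249–301 [Balaban1987RG1] ((0.4), (0.11) p.253).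
-/

set_option autoImplicit false

noncomputable section

open scoped BigOperators Matrix.Norms.L2Operator Topology

namespace Summit.QuantumFields.YangMills.Theorems.Prop7TrueLinCentralRegPr

open NormedSpace
open Literature.MathematicalPhysics.QuantumFieldTheory.Balaban1983to89
open Finset T4Continuum BlockAveraging AveragingRT ExpMeanLog BlockAveragingEMLLinearised BlockAveragingEMLLinearisedBackground BlockAveragingEMLProp2
open LatticeWordStokes (dist1_loopHol_le)
open FederbushMean (dist1_SU_eq)
open T3ContinuumYM3Torus
open T3RegularMinimiser (regThreshold)
open T3PrintedRegularMinimiser (RegPr)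
open Summit.QuantumFields.YangMills.Theorems.IterPlaqSmallAllL (plaqSmall_iter_T3_allL)
open Summit.QuantumFields.YangMills.Theorems.Prop7SymAvgTwSym (loop_budget_eighth)
open Summit.QuantumFields.YangMills.Theorems.Prop7TrueLinCentral (trueLinIter_smul_one_eq' eighth_lt_deltaSU_two)

/-! ## §1 The flat tower -/

section Flat

variable {n : Type*} [Fintype n] [DecidableEq n] [Nonempty n] {P : Params}

/-- **`W̄^{(j)}(1) = 1`** for the printed `exp[mean log]` block averaging at every level (lit `T3DescentFibreTower.avgFun_one` ∘ `expMeanLogSU_E_one`, iterated).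
[cite: Balaban1987RG1, (0.4) p.253, (0.11) p.253] -/
theorem iter_blockAvg_expMeanLogSU_one :
    ∀ j : ℕ, Averaging.iter (fun i => blockAvg (P := P) (j := i) (expMeanLogSU (n := n))) j (1 : GaugeField P 0 (Matrix.specialUnitaryGroup n ℂ)) = 1
  | 0 => rfl
  | j + 1 => by
    show (blockAvg (P := P) (j := j) (expMeanLogSU (n := n))).avg (Averaging.iter (fun i => blockAvg (P := P) (j := i) (expMeanLogSU (n := n))) j 1) = 1
    rw [iter_blockAvg_expMeanLogSU_one j, blockAvg_avg]
    exact T3DescentFibreTower.avgFun_one _ T3DescentFibreTower.expMeanLogSU_E_one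

/-- the loop variables of the flat tower are trivially small. [cite: Balaban1987RG1, (0.4) p.253] -/
theorem loops_iter_one :
    ∀ (j : ℕ) (c : PBond P (j + 1)) (i : Idx P),
      ‖((loopHol (Averaging.iter (fun i => blockAvg (P := P) (j := i) (expMeanLogSU (n := n))) j (1 : GaugeField P 0 (Matrix.specialUnitaryGroup n ℂ))) c i :
          Matrix.specialUnitaryGroup n ℂ) : Matrix n n ℂ) - 1‖ ≤ 1 / 8 ∧
        dist1 (loopHol (Averaging.iter (fun i => blockAvg (P := P) (j := i) (expMeanLogSU (n := n))) j (1 : GaugeField P 0 (Matrix.specialUnitaryGroup n ℂ))) c i) < deltaSU n := by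
  intro j c i
  rw [iter_blockAvg_expMeanLogSU_one, T3DescentFibreTower.loopHol_one]
  refine ⟨?_, ?_⟩
  · rw [OneMemClass.coe_one, sub_self, norm_zero]; norm_num
  · rw [GaugeGroup.dist1_one]; exact deltaSU_pos

end Flat

/-! ## §2 The loop windows at a printed-regular background, SU letters -/

section Member

variable (F : T3Family) {n K : ℕ}

/-- ★ **AT `W ∈ 𝔘_k(ε₀)` EVERY LOOP VARIABLE OF EVERY `W̄^{(j)}`, `j ≤ K − n`, IS WITHIN `1∕8` OF `1` AND ON THE GUARD `δ₂`** ((146) ✓`plaqSmall_iter_T3_allL` ∘ Stokes ✓`dist1_loopHol_le`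
∘ ✓`loop_budget_eighth`; window `10⁷L³ε₀ ≤ 1`). [cite: Balaban1985Variational, (2) p.278, (146) p.301; Balaban1987RG1, (0.4) p.253] -/
theorem loops_iter_le_eighth_of_regPr {ε₀ : ℝ} (hε₀ : 0 < ε₀) (hε : 10 ^ 7 * (F.L : ℝ) ^ 3 * ε₀ ≤ 1)
    {W : GaugeField (F.P K) 0 (Matrix.specialUnitaryGroup (Fin 2) ℂ)} (hreg : RegPr F n K ε₀ W) :
    ∀ j, j ≤ K - n → ∀ (c : PBond (F.P K) (j + 1)) (i : Idx (F.P K)),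
      ‖((loopHol (Averaging.iter (fun i => blockAvg (P := F.P K) (j := i) (expMeanLogSU (n := Fin 2))) j W) c i : Matrix.specialUnitaryGroup (Fin 2) ℂ) : Matrix (Fin 2) (Fin 2) ℂ) - 1‖ ≤ 1 / 8 ∧
        dist1 (loopHol (Averaging.iter (fun i => blockAvg (P := F.P K) (j := i) (expMeanLogSU (n := Fin 2))) j W) c i) < deltaSU (Fin 2) := by
  intro j hj c i
  have ht0 : 0 ≤ (10800 * (F.L : ℝ) + 1) * ((F.L : ℝ) ^ (2 * j) * regThreshold F n K ε₀) := by unfold regThreshold; positivity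
  have hd : dist1 (loopHol (Averaging.iter (fun i => blockAvg (P := F.P K) (j := i) (expMeanLogSU (n := Fin 2))) j W) c i) ≤ 1 / 8 :=
    (dist1_loopHol_le ht0 (plaqSmall_iter_T3_allL F n K hε₀ hε W hreg.plaqSmall j hj) c i).trans (loop_budget_eighth F n K hε₀ hε hj)
  refine ⟨?_, hd.trans_lt eighth_lt_deltaSU_two⟩
  rw [← dist1_SU_eq]; exact hd

/-! ## §3 The curved family equals the flat family on the centre -/

/-- ★★★ **ON `𝔘_k(ε₀)` THE CURVED TRUE-LINEARISED FAMILY EQUALS THE FLAT ONE ON `ℂ·1` AND IS CENTRAL-VALUED**: for the `hQs`-families `Q` (along `W̄^{(·)}`, `W ∈ RegPr F n K ε₀`,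
`10⁷L³ε₀ ≤ 1`) and `Q₁` (along the flat tower) of ✓`hEng_of_trueAvgBudget`'s `hQB` letters, every `k ≤ K − n` and every scalar `c`: `Q k (c·1) = Q₁ k (c·1)` and `∀ e, Q k (c·1) e ∈ ℂ·1`.
[cite: Balaban1984PropagatorsI, (1.18)-(1.20) pp.19-20; Balaban1985BackgroundPropagators, (3.14)-(3.15) p.393; Balaban1985Variational, (2) p.278] -/
theorem trueLinIter_smul_one_eq_flat_of_regPr {ε₀ : ℝ} (hε₀ : 0 < ε₀) (hε : 10 ^ 7 * (F.L : ℝ) ^ 3 * ε₀ ≤ 1)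
    (W : GaugeField (F.P K) 0 (Matrix.specialUnitaryGroup (Fin 2) ℂ)) (hreg : RegPr F n K ε₀ W)
    (Q Q₁ : (k : ℕ) → (PBond (F.P K) 0 → Matrix (Fin 2) (Fin 2) ℂ) → PBond (F.P K) k → Matrix (Fin 2) (Fin 2) ℂ)
    (hQ0 : ∀ Y, Q 0 Y = Y)
    (hQs : ∀ (k : ℕ) (Y : PBond (F.P K) 0 → Matrix (Fin 2) (Fin 2) ℂ) (c : PBond (F.P K) (k + 1)), Q (k + 1) Y c
      = fderiv ℂ (eml : (Idx (F.P K) → Matrix (Fin 2) (Fin 2) ℂ) → Matrix (Fin 2) (Fin 2) ℂ)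
            (fun i => ((loopHol (Averaging.iter (fun i => blockAvg (P := F.P K) (j := i) (expMeanLogSU (n := Fin 2))) k W) c i : Matrix.specialUnitaryGroup (Fin 2) ℂ) : Matrix (Fin 2) (Fin 2) ℂ))
            (fun i => covWalkSum (Averaging.iter (fun i => blockAvg (P := F.P K) (j := i) (expMeanLogSU (n := Fin 2))) k W) (Q k Y) (walk (emb c.src) (loopWord (F.P K).L c.dir (off i.1) i.2.1 i.2.2))
              * ((loopHol (Averaging.iter (fun i => blockAvg (P := F.P K) (j := i) (expMeanLogSU (n := Fin 2))) k W) c i : Matrix.specialUnitaryGroup (Fin 2) ℂ) : Matrix (Fin 2) (Fin 2) ℂ))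
            * star ((corr (expMeanLogSU (n := Fin 2)) (Averaging.iter (fun i => blockAvg (P := F.P K) (j := i) (expMeanLogSU (n := Fin 2))) k W) c : Matrix.specialUnitaryGroup (Fin 2) ℂ) : Matrix (Fin 2) (Fin 2) ℂ)
          + ((corr (expMeanLogSU (n := Fin 2)) (Averaging.iter (fun i => blockAvg (P := F.P K) (j := i) (expMeanLogSU (n := Fin 2))) k W) c : Matrix.specialUnitaryGroup (Fin 2) ℂ) : Matrix (Fin 2) (Fin 2) ℂ)
            * covWalkSum (Averaging.iter (fun i => blockAvg (P := F.P K) (j := i) (expMeanLogSU (n := Fin 2))) k W) (Q k Y) (walk (emb c.src) (List.replicate (F.P K).L (c.dir, true)))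
            * star ((corr (expMeanLogSU (n := Fin 2)) (Averaging.iter (fun i => blockAvg (P := F.P K) (j := i) (expMeanLogSU (n := Fin 2))) k W) c : Matrix.specialUnitaryGroup (Fin 2) ℂ) : Matrix (Fin 2) (Fin 2) ℂ))
    (hQ0₁ : ∀ Y, Q₁ 0 Y = Y)
    (hQs₁ : ∀ (k : ℕ) (Y : PBond (F.P K) 0 → Matrix (Fin 2) (Fin 2) ℂ) (c : PBond (F.P K) (k + 1)), Q₁ (k + 1) Y c
      = fderiv ℂ (eml : (Idx (F.P K) → Matrix (Fin 2) (Fin 2) ℂ) → Matrix (Fin 2) (Fin 2) ℂ)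
            (fun i => ((loopHol (Averaging.iter (fun i => blockAvg (P := F.P K) (j := i) (expMeanLogSU (n := Fin 2))) k (1 : GaugeField (F.P K) 0 (Matrix.specialUnitaryGroup (Fin 2) ℂ))) c i :
              Matrix.specialUnitaryGroup (Fin 2) ℂ) : Matrix (Fin 2) (Fin 2) ℂ))
            (fun i => covWalkSum (Averaging.iter (fun i => blockAvg (P := F.P K) (j := i) (expMeanLogSU (n := Fin 2))) k (1 : GaugeField (F.P K) 0 (Matrix.specialUnitaryGroup (Fin 2) ℂ))) (Q₁ k Y)
                (walk (emb c.src) (loopWord (F.P K).L c.dir (off i.1) i.2.1 i.2.2))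
              * ((loopHol (Averaging.iter (fun i => blockAvg (P := F.P K) (j := i) (expMeanLogSU (n := Fin 2))) k (1 : GaugeField (F.P K) 0 (Matrix.specialUnitaryGroup (Fin 2) ℂ))) c i :
                Matrix.specialUnitaryGroup (Fin 2) ℂ) : Matrix (Fin 2) (Fin 2) ℂ))
            * star ((corr (expMeanLogSU (n := Fin 2)) (Averaging.iter (fun i => blockAvg (P := F.P K) (j := i) (expMeanLogSU (n := Fin 2))) k (1 : GaugeField (F.P K) 0 (Matrix.specialUnitaryGroup (Fin 2) ℂ))) c :
                Matrix.specialUnitaryGroup (Fin 2) ℂ) : Matrix (Fin 2) (Fin 2) ℂ)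
          + ((corr (expMeanLogSU (n := Fin 2)) (Averaging.iter (fun i => blockAvg (P := F.P K) (j := i) (expMeanLogSU (n := Fin 2))) k (1 : GaugeField (F.P K) 0 (Matrix.specialUnitaryGroup (Fin 2) ℂ))) c :
                Matrix.specialUnitaryGroup (Fin 2) ℂ) : Matrix (Fin 2) (Fin 2) ℂ)
            * covWalkSum (Averaging.iter (fun i => blockAvg (P := F.P K) (j := i) (expMeanLogSU (n := Fin 2))) k (1 : GaugeField (F.P K) 0 (Matrix.specialUnitaryGroup (Fin 2) ℂ))) (Q₁ k Y)
                (walk (emb c.src) (List.replicate (F.P K).L (c.dir, true)))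
            * star ((corr (expMeanLogSU (n := Fin 2)) (Averaging.iter (fun i => blockAvg (P := F.P K) (j := i) (expMeanLogSU (n := Fin 2))) k (1 : GaugeField (F.P K) 0 (Matrix.specialUnitaryGroup (Fin 2) ℂ))) c :
                Matrix.specialUnitaryGroup (Fin 2) ℂ) : Matrix (Fin 2) (Fin 2) ℂ))
    {k : ℕ} (hk : k ≤ K - n) (c : PBond (F.P K) 0 → ℂ) :
    Q k (fun b => c b • (1 : Matrix (Fin 2) (Fin 2) ℂ)) = Q₁ k (fun b => c b • (1 : Matrix (Fin 2) (Fin 2) ℂ)) ∧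
      ∀ e : PBond (F.P K) k, ∃ s : ℂ, Q k (fun b => c b • (1 : Matrix (Fin 2) (Fin 2) ℂ)) e = s • (1 : Matrix (Fin 2) (Fin 2) ℂ) :=
  trueLinIter_smul_one_eq' W 1 Q Q₁ hQ0 hQs hQ0₁ hQs₁ k
    (fun j hj c' i => loops_iter_le_eighth_of_regPr F hε₀ hε hreg j (by omega) c' i) (fun j _ c' i => loops_iter_one j c' i) c

end Member

end Summit.QuantumFields.YangMills.Theorems.Prop7TrueLinCentralRegPr

end
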